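import Summits.KontsevichZagierPeriods.KontsevichZagierPeriods.Theses.FermatIsogeny
import Literature.NumberTheory.Transcendental.GammaMonomialsProofs

/-!
# FermatIsogeny deep targets — the DIRICHLET MOVE, typed (decomp-kz · lens-5 · g22, companion file C; STANDALONE, tree-only imports)

Instrument 2 of this generation (`instrument/class_reps.{py,json,md}`) found: at level `N = 3` ALL 9 same-type classes of
2-letter Beta words (1359 ordered same-type pairs) are connected by the moves the node file already has as theorems/hypotheses —
symmetry `B(a,b) = B(b,a)` (S), unit letters `B(a,1) = 1/a` (U), translation `(a+b)B(a,b+1) = bB(a,b)` (T) — plus EXACTLY ONE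
instance of a fourth move, DIRICHLET's formula
  `B(a,b)·B(a+b,c) = Γ(a)Γ(b)Γ(c)/Γ(a+b+c) = B(b,c)·B(a,b+c)`,
namely `D(⅓,⅓,⅔)`: `B(⅓,⅓)·B(⅔,⅔) ∼ B(⅓,⅔)·B(⅓,1) (= 3·B(⅓,⅔))`.  (At level 4 one needs in addition Legendre's duplication;
8/9 classes then connect, the ninth needs `B(¼,¾) ∼ √2·B(½,½)`.)

This file TYPES the Dirichlet move as a KZ statement on 2-letter words in exactly the integrand format of the box statements
(`BetaDirichletMove`), proves the underlying VALUE identity (`beta_dirichlet`) and the level-3 instance as a real-number identity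
(`dirichlet_third`), so that g23 has the precise target:  PROVE `BetaDirichletMove` from the tree's move calculus
(the substitution `(x,y) ↦ (xy, (1−x)y)` of the open square onto the open 2-simplex has Jacobian `y` and carries
`x^{a−1}(1−x)^{b−1}·y^{a+b−1}(1−y)^{c−1} dxdy` to the Dirichlet form `u^{a−1}v^{b−1}(1−u−v)^{c−1} dudv`, which is symmetric under the
linear automorphisms of the simplex permuting `(u,a),(v,b),(1−u−v,c)`; two such substitutions + one permutation = the move), and then
`BetaDirichletMove → BoxChain 2 3 (SameType 3)` by the class calculus of the node file (normal form `X^x Y^y Z^z`, `X = [B(⅓,⅔)]`,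
`Y = [B(⅓,⅓)]`, `Z = [B(⅔,⅔)]`, relation `Y·Z = 3·X`).  Sorry-free; no new axiom; nothing here is used as a fact.
-/

noncomputable section

open Literature.NumberTheory.Transcendental

namespace Summit.KontsevichZagierPeriods.FermatIsogeny.DeepTargets.Dirichlet

/-- **The Dirichlet move, typed** (HYPOTHESIS / g23 TARGET — expected PROVABLE from the KZ move calculus, see the module docstring):
for rational `a, b, c > 0`, the 2-letter Beta words with exponent rows `(a,b),(a+b,c)` and `(b,c),(a,b+c)`, pinned on the open square,
are KZ-equivalent.  Value identity: `B(a,b)B(a+b,c) = B(b,c)B(a,b+c)` (`beta_dirichlet`). (cite AndrewsAskeyRoy1999, Thm 1.8.6 (Dirichlet)) -/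
def BetaDirichletMove : Prop :=
  ∀ (a b c : ℚ), 0 < a → 0 < b → 0 < c → ∀ (ρ ρ' : KZ.IntegralRep 2),
    ρ.domain = {x | ∀ i, x i ∈ Set.Ioo (0:ℝ) 1} →
    Set.EqOn ρ.integrand (fun x => ∏ i, (x i) ^ (((![a, a + b] : Fin 2 → ℚ) i : ℝ) - 1)
        * (1 - x i) ^ (((![b, c] : Fin 2 → ℚ) i : ℝ) - 1)) ρ.domain →
    ρ'.domain = {x | ∀ i, x i ∈ Set.Ioo (0:ℝ) 1} →
    Set.EqOn ρ'.integrand (fun x => ∏ i, (x i) ^ (((![b, a] : Fin 2 → ℚ) i : ℝ) - 1)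
        * (1 - x i) ^ (((![c, b + c] : Fin 2 → ℚ) i : ℝ) - 1)) ρ'.domain →
    KZ.Equivalent ρ ρ'

/-- Euler's Beta value `B(x,y) = Γ(x)Γ(y)/Γ(x+y)` (real, for bookkeeping). (cite AndrewsAskeyRoy1999, Thm 1.1.4) -/
def B (x y : ℝ) : ℝ := Real.Gamma x * Real.Gamma y / Real.Gamma (x + y)

/-- **Dirichlet's formula** as a value identity: `B(a,b)·B(a+b,c) = B(b,c)·B(a,b+c)` (`a, b, c > 0`); both sides equal
`Γ(a)Γ(b)Γ(c)/Γ(a+b+c)`. (cite AndrewsAskeyRoy1999, Thm 1.8.6) -/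
theorem beta_dirichlet {a b c : ℝ} (ha : 0 < a) (hb : 0 < b) (hc : 0 < c) :
    B a b * B (a + b) c = B b c * B a (b + c) := by
  unfold B
  have h1 : Real.Gamma (a + b) ≠ 0 := (Real.Gamma_pos_of_pos (by linarith)).ne'
  have h2 : Real.Gamma (b + c) ≠ 0 := (Real.Gamma_pos_of_pos (by linarith)).ne'
  have h3 : Real.Gamma (a + b + c) ≠ 0 := (Real.Gamma_pos_of_pos (by linarith)).ne'
  rw [show a + (b + c) = a + b + c by ring]
  field_simp

/-- Both sides of Dirichlet's formula are the trinomial Beta value `Γ(a)Γ(b)Γ(c)/Γ(a+b+c)`. (cite AndrewsAskeyRoy1999, Thm 1.8.6) -/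
theorem beta_dirichlet_eq_trinomial {a b c : ℝ} (ha : 0 < a) (hb : 0 < b) :
    B a b * B (a + b) c = Real.Gamma a * Real.Gamma b * Real.Gamma c / Real.Gamma (a + b + c) := by
  unfold B
  have h1 : Real.Gamma (a + b) ≠ 0 := (Real.Gamma_pos_of_pos (by linarith)).ne'
  field_simp

/-- Unit letters: `B(a,1) = 1/a` (`a > 0`). (cite AndrewsAskeyRoy1999, §1.1) -/
theorem B_one_right {a : ℝ} (ha : 0 < a) : B a 1 = 1 / a := by
  unfold B
  rw [Real.Gamma_one, Real.Gamma_add_one ha.ne']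
  have hG : Real.Gamma a ≠ 0 := (Real.Gamma_pos_of_pos ha).ne'
  field_simp

/-- **The level-3 instance found by the instrument**: `B(⅓,⅓)·B(⅔,⅔) = 3·B(⅓,⅔)` — Dirichlet `D(⅓,⅓,⅔)` followed by the unit
letter `B(⅓,1) = 3`.  This is the ONE relation beyond S/U/T needed to connect all level-3 same-type classes of 2-letter words
(`instrument/class_reps.md`). [this node] -/
theorem dirichlet_third : B (1/3) (1/3) * B (2/3) (2/3) = 3 * B (1/3) (2/3) := by
  have h := beta_dirichlet (a := (1:ℝ)/3) (b := 1/3) (c := 2/3) (by norm_num) (by norm_num) (by norm_num)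
  rw [show (1:ℝ)/3 + 1/3 = 2/3 by norm_num, show (1:ℝ)/3 + 2/3 = 1 by norm_num, B_one_right (by norm_num)] at h
  rw [h]; ring

/-- The same instance through Γ: `Γ(⅓)²/Γ(⅔) · Γ(⅔)²/Γ(4/3) = 3·Γ(⅓)Γ(⅔)` (uses only `Γ(s+1) = sΓ(s)`, `Γ(1) = 1`). [this node] -/
theorem dirichlet_third_gamma :
    Real.Gamma (1/3) ^ 2 / Real.Gamma (2/3) * (Real.Gamma (2/3) ^ 2 / Real.Gamma (4/3))
      = 3 * (Real.Gamma (1/3) * Real.Gamma (2/3)) := by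
  have h13 : Real.Gamma ((1:ℝ)/3) ≠ 0 := (Real.Gamma_pos_of_pos (by norm_num)).ne'
  have h23 : Real.Gamma ((2:ℝ)/3) ≠ 0 := (Real.Gamma_pos_of_pos (by norm_num)).ne'
  have h43 : Real.Gamma ((4:ℝ)/3) = 1/3 * Real.Gamma (1/3) := by
    rw [show (4:ℝ)/3 = 1/3 + 1 by norm_num, Real.Gamma_add_one (by norm_num)]
  rw [h43]
  field_simp

/-- **Value consistency of the typed move at the instance**: the two words of `BetaDirichletMove` at `(a,b,c) = (⅓,⅓,⅔)` have equal
Beta products, `B(⅓,⅓)B(⅔,⅔) = B(⅓,⅔)B(⅓,1)` — so the move is not refutable by values (a necessary condition for KZ-equivalence).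
[this node] -/
theorem dirichletMove_third_values : B (1/3) (1/3) * B (1/3 + 1/3) (2/3) = B (1/3) (2/3) * B (1/3) (1/3 + 2/3) :=
  beta_dirichlet (by norm_num) (by norm_num) (by norm_num)

/-- Legendre at level 4, the instrument's other finding, as a value identity: `B(¼,¼)·B(½,½)… ` — precisely
`Γ(¼)Γ(¾) = √2·π` (reflection), i.e. `B(¼,¾) = √2·B(½,½)`; recorded here as the real identity `Γ(¼)Γ(¾) = π·√2`.
(cite AndrewsAskeyRoy1999, Thm 1.2.1 (reflection)) -/
theorem gamma_quarter_reflection : Real.Gamma (1/4) * Real.Gamma (3/4) = Real.pi * Real.sqrt 2 := by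
  have h := Real.Gamma_mul_Gamma_one_sub ((1:ℝ)/4)
  rw [show (1:ℝ) - 1/4 = 3/4 by norm_num, show Real.pi * (1/4) = Real.pi / 4 by ring, Real.sin_pi_div_four] at h
  have hs : Real.sqrt 2 ≠ 0 := Real.sqrt_ne_zero'.mpr (by norm_num)
  have hss : Real.sqrt 2 * Real.sqrt 2 = 2 := Real.mul_self_sqrt (by norm_num)
  have h2 : (2:ℝ) / Real.sqrt 2 = Real.sqrt 2 := by rw [div_eq_iff hs]; exact hss.symm
  rw [h, div_div_eq_mul_div, mul_div_assoc, h2]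

end Summit.KontsevichZagierPeriods.FermatIsogeny.DeepTargets.Dirichlet
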